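import Mathlib.Analysis.SpecialFunctions.Pow.Deriv
import Mathlib.Analysis.SpecialFunctions.Pow.Continuity
import Mathlib.Analysis.SpecialFunctions.Sqrt
import Mathlib.Analysis.Convex.Deriv
import Mathlib.Analysis.Calculus.Deriv.Slope
import HarnessLib

/-!
# K16 (part 1 of 2) — the test-line toolkit for the general-`q` share ceiling `c_axi(q)`: the dictionary constants
# `S_q, B_q, R_q, c_axi(q)`, the one-variable functions of the line `diag(u, 1 − 2u, u − 1)` for every real `q`,
# and their wall values at `u = 2/3`

search for candidate a priori estimates; no regularity claim.

Pure one-variable real analysis (Mathlib only): §1 constants and atoms, §2 the line functions and their derivatives,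
§3 the wall values at `u = 2/3`. The wall lemma, the flat case, the necessity theorem
`topBotEigSplitting_share_le_cAxi` and the by-value corollaries are PART 2.

FILEABLE FORM (400-line lint) — PART 1 of 2 of the staged monolith `NoGo/TopBotEigSplitShareWall.STAGING.lean` 22c1960263dbb788 (661 l.):
this file = its sections before `## 4.` (declarations byte-identical, same order); PART 2 =
`NoGo/TopBotEigSplitShareWallMain.lean` (the remaining sections and the headline; it imports this file).
search for candidate a priori estimates; no regularity claim.
FILING (prove seat g26, REQUEST #31′ part 1 of 2 (nogo g43 touch 4, HOME INBOX l.4686: two-part pure cut of the certified monolith `TopBotEigSplitShareWall.STAGING.lean` 22c1960263dbb788 for the 400-line lint; LEAD RULING (ηη) slot #31)): declarations byte-identical to the no-go seat's staged `TopBotEigSplitShareWallLine.STAGING.lean` 9231c4a3ff05327d; this line is the only addition.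
-/

open Set Filter Topology

noncomputable section

namespace Summit.NavierStokesRegularity.FunctionalMining

namespace TopEig

/-! ## 1. The dictionary constants and the atoms `P = 2^{q/2}`, `Q = 3^{q/2}` -/

/-- `S_q = (2^q + 1)·6^{−q/2}` (dictionary block 55). [dictionary; bookkeeping] -/
def axiS (q : ℝ) : ℝ := ((2 : ℝ) ^ q + 1) * (6 : ℝ) ^ (-(q / 2))

/-- `B_q = ((q − 1)/2)·6^{1 − q/2}` (dictionary block 55). [dictionary; bookkeeping] -/
def axiB (q : ℝ) : ℝ := (q - 1) / 2 * (6 : ℝ) ^ (1 - q / 2)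

/-- `R_q = ((q − 1)/2)·6^{1 − q}` (dictionary block 55). [dictionary; bookkeeping] -/
def axiR (q : ℝ) : ℝ := (q - 1) / 2 * (6 : ℝ) ^ (1 - q)

/-- **The axisymmetric share** `c_axi(q) = ½[(S_q + B_q) − √((S_q − B_q)² + 4R_q)]` (dictionary block 55,
DICTIONARY l.244). [dictionary; ours as a Lean constant] -/
def cAxi (q : ℝ) : ℝ := ((axiS q + axiB q) - Real.sqrt ((axiS q - axiB q) ^ 2 + 4 * axiR q)) / 2

/-- The atom `P = 2^{q/2}`. [bookkeeping] -/
def axiP (q : ℝ) : ℝ := (2 : ℝ) ^ (q / 2)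

/-- The atom `Q = 3^{q/2}`. [bookkeeping] -/
def axiQ (q : ℝ) : ℝ := (3 : ℝ) ^ (q / 2)

/-- `P > 0`. [bookkeeping] -/
theorem axiP_pos (q : ℝ) : 0 < axiP q := Real.rpow_pos_of_pos two_pos _

/-- `Q > 0`. [bookkeeping] -/
theorem axiQ_pos (q : ℝ) : 0 < axiQ q := Real.rpow_pos_of_pos three_pos _

/-- `2^q = P²`. [bookkeeping] -/
theorem two_rpow_axi (q : ℝ) : (2 : ℝ) ^ q = axiP q ^ 2 := by
  rw [show q = q / 2 + q / 2 by ring, Real.rpow_add two_pos, axiP]; ring_nf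

/-- `3^q = Q²`. [bookkeeping] -/
theorem three_rpow_axi (q : ℝ) : (3 : ℝ) ^ q = axiQ q ^ 2 := by
  rw [show q = q / 2 + q / 2 by ring, Real.rpow_add three_pos, axiQ]; ring_nf

/-- `6^{q/2} = PQ`. [bookkeeping] -/
theorem six_rpow_half (q : ℝ) : (6 : ℝ) ^ (q / 2) = axiP q * axiQ q := by
  rw [show (6 : ℝ) = 2 * 3 by norm_num, Real.mul_rpow (by norm_num) (by norm_num), axiP, axiQ]

/-- `6^{−q/2} = 1/(PQ)`. [bookkeeping] -/
theorem six_rpow_neg_half (q : ℝ) : (6 : ℝ) ^ (-(q / 2)) = 1 / (axiP q * axiQ q) := by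
  rw [Real.rpow_neg (by norm_num), six_rpow_half, one_div]

/-- `6^{1 − q/2} = 6/(PQ)`. [bookkeeping] -/
theorem six_rpow_one_sub_half (q : ℝ) : (6 : ℝ) ^ (1 - q / 2) = 6 / (axiP q * axiQ q) := by
  rw [Real.rpow_sub (by norm_num), Real.rpow_one, six_rpow_half]

/-- `6^{1 − q} = 6/(PQ)²`. [bookkeeping] -/
theorem six_rpow_one_sub (q : ℝ) : (6 : ℝ) ^ (1 - q) = 6 / (axiP q * axiQ q) ^ 2 := by
  rw [Real.rpow_sub (by norm_num), Real.rpow_one, show q = q / 2 + q / 2 by ring,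
    Real.rpow_add (by norm_num), six_rpow_half]
  ring_nf

/-- `S_q = (P² + 1)/(PQ)`. [bookkeeping] -/
theorem axiS_eq (q : ℝ) : axiS q = (axiP q ^ 2 + 1) / (axiP q * axiQ q) := by
  rw [axiS, two_rpow_axi, six_rpow_neg_half]; ring

/-- `B_q = 3(q − 1)/(PQ)`. [bookkeeping] -/
theorem axiB_eq (q : ℝ) : axiB q = 3 * (q - 1) / (axiP q * axiQ q) := by
  rw [axiB, six_rpow_one_sub_half]; ring

/-- `R_q = 3(q − 1)/(PQ)²`. [bookkeeping] -/
theorem axiR_eq (q : ℝ) : axiR q = 3 * (q - 1) / (axiP q * axiQ q) ^ 2 := by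
  rw [axiR, six_rpow_one_sub]; ring

/-- `(2/3)^q = P²/Q²`. [bookkeeping] -/
theorem twoThirds_rpow (q : ℝ) : (2 / 3 : ℝ) ^ q = axiP q ^ 2 / axiQ q ^ 2 := by
  rw [Real.div_rpow (by norm_num) (by norm_num), two_rpow_axi, three_rpow_axi]

/-- `(1/3)^q = 1/Q²`. [bookkeeping] -/
theorem oneThird_rpow (q : ℝ) : (1 / 3 : ℝ) ^ q = 1 / axiQ q ^ 2 := by
  rw [Real.div_rpow (by norm_num) (by norm_num), Real.one_rpow, three_rpow_axi]

/-- `(2/3)^{q/2} = P/Q`. [bookkeeping] -/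
theorem twoThirds_rpow_half (q : ℝ) : (2 / 3 : ℝ) ^ (q / 2) = axiP q / axiQ q := by
  rw [Real.div_rpow (by norm_num) (by norm_num), axiP, axiQ]

/-- `(2/3)^{q−1} = (3/2)P²/Q²`. [bookkeeping] -/
theorem twoThirds_rpow_sub_one (q : ℝ) : (2 / 3 : ℝ) ^ (q - 1) = 3 / 2 * (axiP q ^ 2 / axiQ q ^ 2) := by
  rw [Real.rpow_sub (by norm_num), Real.rpow_one, twoThirds_rpow]; ring

/-- `(1/3)^{q−1} = 3/Q²`. [bookkeeping] -/
theorem oneThird_rpow_sub_one (q : ℝ) : (1 / 3 : ℝ) ^ (q - 1) = 3 / axiQ q ^ 2 := by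
  rw [Real.rpow_sub (by norm_num), Real.rpow_one, oneThird_rpow]; ring

/-- `(2/3)^{q−2} = (9/4)P²/Q²`. [bookkeeping] -/
theorem twoThirds_rpow_sub_two (q : ℝ) : (2 / 3 : ℝ) ^ (q - 2) = 9 / 4 * (axiP q ^ 2 / axiQ q ^ 2) := by
  rw [Real.rpow_sub (by norm_num), Real.rpow_two, twoThirds_rpow]; ring

/-- `(1/3)^{q−2} = 9/Q²`. [bookkeeping] -/
theorem oneThird_rpow_sub_two (q : ℝ) : (1 / 3 : ℝ) ^ (q - 2) = 9 / axiQ q ^ 2 := by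
  rw [Real.rpow_sub (by norm_num), Real.rpow_two, oneThird_rpow]; ring

/-- `(2/3)^{q/2−1} = (3/2)P/Q`. [bookkeeping] -/
theorem twoThirds_rpow_half_sub_one (q : ℝ) : (2 / 3 : ℝ) ^ (q / 2 - 1) = 3 / 2 * (axiP q / axiQ q) := by
  rw [Real.rpow_sub (by norm_num), Real.rpow_one, twoThirds_rpow_half]; ring

/-- `(2/3)^{q/2−2} = (9/4)P/Q`. [bookkeeping] -/
theorem twoThirds_rpow_half_sub_two (q : ℝ) : (2 / 3 : ℝ) ^ (q / 2 - 2) = 9 / 4 * (axiP q / axiQ q) := by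
  rw [Real.rpow_sub (by norm_num), Real.rpow_two, twoThirds_rpow_half]; ring

/-! ## 2. The one-variable functions of the line, every real `q` -/

/-- `‖A(u)‖² = 6u² − 6u + 2` as a function of `u`. [bookkeeping] -/
def lineNsq (u : ℝ) : ℝ := 6 * u ^ 2 - 6 * u + 2

/-- `6u² − 6u + 2 = 6(u − 1/2)² + 1/2 > 0`. [bookkeeping] -/
theorem lineNsq_pos (u : ℝ) : 0 < lineNsq u := by
  unfold lineNsq; nlinarith [sq_nonneg (u - 1 / 2)]

/-- `(6u² − 6u + 2)′ = 12u − 6`. [bookkeeping] -/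
theorem hasDerivAt_lineNsq (u : ℝ) : HasDerivAt lineNsq (12 * u - 6) u := by
  have h : HasDerivAt (fun x : ℝ => 6 * x ^ 2 - 6 * x + 2) (6 * (2 * u) - 6) u := by
    simpa using ((((hasDerivAt_id' u).pow 2).const_mul 6).sub ((hasDerivAt_id' u).const_mul 6)).add_const 2
  have e : (fun x : ℝ => 6 * x ^ 2 - 6 * x + 2) = lineNsq := by funext x; rfl
  rw [e] at h
  convert h using 1; ring

/-- `N(u) = u^q + (1 − u)^q − c(6u² − 6u + 2)^{q/2}` (= `λ^q + λ(−·)^q − c‖·‖^q` along the line on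
`[1/3, 2/3]`). [ours] -/
def lineN (q c u : ℝ) : ℝ := u ^ q + (1 - u) ^ q - c * lineNsq u ^ (q / 2)

/-- The closed form of `N′` on `(0, 1)`. [ours] -/
def lineN1 (q c u : ℝ) : ℝ :=
  q * u ^ (q - 1) - q * (1 - u) ^ (q - 1) - c * (q / 2) * lineNsq u ^ (q / 2 - 1) * (12 * u - 6)

/-- The closed form of `N″` on `(0, 1)`. [ours] -/
def lineN2 (q c u : ℝ) : ℝ :=
  q * (q - 1) * u ^ (q - 2) + q * (q - 1) * (1 - u) ^ (q - 2) -
    c * ((q / 2) * (q / 2 - 1) * lineNsq u ^ (q / 2 - 2) * (12 * u - 6) ^ 2 +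
      (q / 2) * lineNsq u ^ (q / 2 - 1) * 12)

/-- `T = q·N·N″ − (q−1)·N′²` (the numerator of `(N^{1/q})″`). [ours] -/
def lineT (q c u : ℝ) : ℝ := q * lineN q c u * lineN2 q c u - (q - 1) * lineN1 q c u ^ 2

/-- `N′ = N1` on `(0, 1)`. [bookkeeping] -/
theorem hasDerivAt_lineN (q c : ℝ) {u : ℝ} (hu0 : 0 < u) (hu1 : u < 1) :
    HasDerivAt (lineN q c) (lineN1 q c u) u := by
  have h1 : HasDerivAt (fun x : ℝ => x ^ q) (1 * q * u ^ (q - 1)) u :=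
    (hasDerivAt_id u).rpow_const (Or.inl hu0.ne')
  have h2 : HasDerivAt (fun x : ℝ => (1 - x) ^ q) (-1 * q * (1 - u) ^ (q - 1)) u :=
    ((hasDerivAt_id u).const_sub 1).rpow_const (Or.inl (by simp; linarith))
  have h3 : HasDerivAt (fun x : ℝ => lineNsq x ^ (q / 2)) ((12 * u - 6) * (q / 2) * lineNsq u ^ (q / 2 - 1)) u :=
    (hasDerivAt_lineNsq u).rpow_const (Or.inl (lineNsq_pos u).ne')
  have h : HasDerivAt (fun x : ℝ => x ^ q + (1 - x) ^ q - c * lineNsq x ^ (q / 2)) _ u :=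
    (h1.add h2).sub (h3.const_mul c)
  show HasDerivAt (fun x : ℝ => x ^ q + (1 - x) ^ q - c * lineNsq x ^ (q / 2)) (lineN1 q c u) u
  convert h using 1
  simp only [lineN1]; ring

/-- `N″ = N2` on `(0, 1)`. [bookkeeping] -/
theorem hasDerivAt_lineN1 (q c : ℝ) {u : ℝ} (hu0 : 0 < u) (hu1 : u < 1) :
    HasDerivAt (lineN1 q c) (lineN2 q c u) u := by
  have h1 : HasDerivAt (fun x : ℝ => q * x ^ (q - 1)) (q * (1 * (q - 1) * u ^ (q - 1 - 1))) u :=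
    ((hasDerivAt_id u).rpow_const (Or.inl hu0.ne')).const_mul q
  have h2 : HasDerivAt (fun x : ℝ => q * (1 - x) ^ (q - 1))
      (q * (-1 * (q - 1) * (1 - u) ^ (q - 1 - 1))) u :=
    (((hasDerivAt_id u).const_sub 1).rpow_const (Or.inl (by simp; linarith))).const_mul q
  have h3 : HasDerivAt (fun x : ℝ => lineNsq x ^ (q / 2 - 1))
      ((12 * u - 6) * (q / 2 - 1) * lineNsq u ^ (q / 2 - 1 - 1)) u :=
    (hasDerivAt_lineNsq u).rpow_const (Or.inl (lineNsq_pos u).ne')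
  have h4 : HasDerivAt (fun x : ℝ => 12 * x - 6) (12 * 1) u :=
    ((hasDerivAt_id u).const_mul 12).sub_const 6
  have h5 : HasDerivAt (fun x : ℝ => c * (q / 2) * lineNsq x ^ (q / 2 - 1) * (12 * x - 6))
      (c * (q / 2) * ((12 * u - 6) * (q / 2 - 1) * lineNsq u ^ (q / 2 - 1 - 1)) * (12 * u - 6) +
        c * (q / 2) * lineNsq u ^ (q / 2 - 1) * (12 * 1)) u :=
    (h3.const_mul (c * (q / 2))).mul h4
  have h : HasDerivAt (fun x : ℝ => q * x ^ (q - 1) - q * (1 - x) ^ (q - 1) -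
      c * (q / 2) * lineNsq x ^ (q / 2 - 1) * (12 * x - 6)) _ u := (h1.sub h2).sub h5
  rw [show q - 1 - 1 = q - 2 by ring, show q / 2 - 1 - 1 = q / 2 - 2 by ring] at h
  show HasDerivAt (fun x : ℝ => q * x ^ (q - 1) - q * (1 - x) ^ (q - 1) -
      c * (q / 2) * lineNsq x ^ (q / 2 - 1) * (12 * x - 6)) (lineN2 q c u) u
  convert h using 1
  simp only [lineN2]; ring

/-- `N2` is continuous on `(0, 1)`. [bookkeeping] -/
theorem continuousAt_lineN2 (q c : ℝ) {u : ℝ} (hu0 : 0 < u) (hu1 : u < 1) :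
    ContinuousAt (lineN2 q c) u := by
  have c1 : ContinuousAt (fun x : ℝ => x ^ (q - 2)) u :=
    continuousAt_id.rpow_const (Or.inl hu0.ne')
  have c2 : ContinuousAt (fun x : ℝ => (1 - x) ^ (q - 2)) u :=
    (continuousAt_const.sub continuousAt_id).rpow_const (Or.inl (by simp; linarith))
  have cn : ContinuousAt lineNsq u := (hasDerivAt_lineNsq u).continuousAt
  have c3 : ContinuousAt (fun x : ℝ => lineNsq x ^ (q / 2 - 2)) u := cn.rpow_const (Or.inl (lineNsq_pos u).ne')
  have c4 : ContinuousAt (fun x : ℝ => lineNsq x ^ (q / 2 - 1)) u := cn.rpow_const (Or.inl (lineNsq_pos u).ne')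
  have c5 : ContinuousAt (fun x : ℝ => 12 * x - 6) u := by fun_prop
  have h : ContinuousAt (fun x : ℝ => q * (q - 1) * x ^ (q - 2) + q * (q - 1) * (1 - x) ^ (q - 2) -
      c * ((q / 2) * (q / 2 - 1) * lineNsq x ^ (q / 2 - 2) * (12 * x - 6) ^ 2 +
        (q / 2) * lineNsq x ^ (q / 2 - 1) * 12)) u :=
    ((c1.const_mul _).add (c2.const_mul _)).sub
      ((((c3.const_mul _).mul (c5.pow 2)).add ((c4.const_mul _).mul continuousAt_const)).const_mul c)
  have e : (fun x : ℝ => q * (q - 1) * x ^ (q - 2) + q * (q - 1) * (1 - x) ^ (q - 2) -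
      c * ((q / 2) * (q / 2 - 1) * lineNsq x ^ (q / 2 - 2) * (12 * x - 6) ^ 2 +
        (q / 2) * lineNsq x ^ (q / 2 - 1) * 12)) = lineN2 q c := by funext x; rfl
  rwa [e] at h

/-- `N`, `T` are continuous on `(0, 1)`. [bookkeeping] -/
theorem continuousAt_lineN_lineT (q c : ℝ) {u : ℝ} (hu0 : 0 < u) (hu1 : u < 1) :
    ContinuousAt (lineN q c) u ∧ ContinuousAt (lineT q c) u := by
  have cN := (hasDerivAt_lineN q c hu0 hu1).continuousAt
  have cN1 := (hasDerivAt_lineN1 q c hu0 hu1).continuousAt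
  have cN2 := continuousAt_lineN2 q c hu0 hu1
  refine ⟨cN, ?_⟩
  have h : ContinuousAt (fun x => q * lineN q c x * lineN2 q c x - (q - 1) * lineN1 q c x ^ 2) u :=
    ((cN.const_mul q).mul cN2).sub ((cN1.pow 2).const_mul _)
  have e : (fun x => q * lineN q c x * lineN2 q c x - (q - 1) * lineN1 q c x ^ 2) = lineT q c := by funext x; rfl
  rwa [e] at h

/-! ## 3. The wall values at `u = 2/3` -/

/-- `‖A(2/3)‖² = 2/3`. [bookkeeping] -/
theorem lineNsq_two_thirds : lineNsq (2 / 3) = 2 / 3 := by norm_num [lineNsq]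

/-- `‖A(1/3)‖² = 2/3`. [bookkeeping] -/
theorem lineNsq_one_third : lineNsq (1 / 3) = 2 / 3 := by norm_num [lineNsq]

/-- **`N(2/3) = (P/Q)(S_q − c)`.** [ours] -/
theorem lineN_two_thirds (q c : ℝ) : lineN q c (2 / 3) = axiP q / axiQ q * (axiS q - c) := by
  have hP := axiP_pos q; have hQ := axiQ_pos q
  rw [lineN, lineNsq_two_thirds, show (1 : ℝ) - 2 / 3 = 1 / 3 by norm_num, twoThirds_rpow, oneThird_rpow,
    twoThirds_rpow_half, axiS_eq]
  field_simp

/-- `N(1/3) = N(2/3)`. [bookkeeping] -/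
theorem lineN_one_third (q c : ℝ) : lineN q c (1 / 3) = axiP q / axiQ q * (axiS q - c) := by
  rw [← lineN_two_thirds, lineN, lineN, lineNsq_one_third, lineNsq_two_thirds,
    show (1 : ℝ) - 1 / 3 = 2 / 3 by norm_num, show (1 : ℝ) - 2 / 3 = 1 / 3 by norm_num]
  ring

/-- `N′(2/3) = (3q/2)(P² − 2 − cPQ)/Q²`. [bookkeeping] -/
theorem lineN1_two_thirds (q c : ℝ) :
    lineN1 q c (2 / 3) = 3 * q / 2 * ((axiP q ^ 2 - 2 - c * axiP q * axiQ q) / axiQ q ^ 2) := by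
  have hP := axiP_pos q; have hQ := axiQ_pos q
  rw [lineN1, lineNsq_two_thirds, show (1 : ℝ) - 2 / 3 = 1 / 3 by norm_num, twoThirds_rpow_sub_one,
    oneThird_rpow_sub_one, twoThirds_rpow_half_sub_one]
  field_simp
  ring

/-- `N″(2/3) = (9q/4)[(q−1)(P² + 4)/Q² − c(q+2)P/Q]`. [bookkeeping] -/
theorem lineN2_two_thirds (q c : ℝ) :
    lineN2 q c (2 / 3) = 9 * q / 4 * ((q - 1) * (axiP q ^ 2 + 4) / axiQ q ^ 2 - c * (q + 2) * axiP q / axiQ q) := by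
  have hP := axiP_pos q; have hQ := axiQ_pos q
  rw [lineN2, lineNsq_two_thirds, show (1 : ℝ) - 2 / 3 = 1 / 3 by norm_num, twoThirds_rpow_sub_two,
    oneThird_rpow_sub_two, twoThirds_rpow_half_sub_two, twoThirds_rpow_half_sub_one]
  field_simp
  ring

/-- **The wall identity** `T(2/3) = (27/4)q²(P/Q)²[(c − (S_q + B_q)/2)² − ((S_q − B_q)² + 4R_q)/4]`. [ours] -/
theorem lineT_two_thirds (q c : ℝ) :
    lineT q c (2 / 3) = 27 / 4 * q ^ 2 * (axiP q / axiQ q) ^ 2 *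
      ((c - (axiS q + axiB q) / 2) ^ 2 - ((axiS q - axiB q) ^ 2 + 4 * axiR q) / 4) := by
  have hP := axiP_pos q; have hQ := axiQ_pos q
  rw [lineT, lineN_two_thirds, lineN1_two_thirds, lineN2_two_thirds, axiS_eq, axiB_eq, axiR_eq]
  field_simp
  ring

/-- `R_q > 0` for `q > 1`. [bookkeeping] -/
theorem axiR_pos {q : ℝ} (hq : 1 < q) : 0 < axiR q := by
  rw [axiR_eq]; have hP := axiP_pos q; have hQ := axiQ_pos q
  exact div_pos (by linarith) (by positivity)

/-- `0 < S_q`. [bookkeeping] -/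
theorem axiS_pos (q : ℝ) : 0 < axiS q := by
  rw [axiS_eq]; have hP := axiP_pos q; have hQ := axiQ_pos q; positivity

/-- The discriminant exceeds `(S_q − B_q)²` for `q > 1`. [bookkeeping] -/
theorem axi_disc_gt {q : ℝ} (hq : 1 < q) : (axiS q - axiB q) ^ 2 < (axiS q - axiB q) ^ 2 + 4 * axiR q := by
  linarith [axiR_pos hq]

/-- **`c_axi(q) < S_q`** for `q > 1`. [ours] -/
theorem cAxi_lt_axiS {q : ℝ} (hq : 1 < q) : cAxi q < axiS q := by
  have h1 : |axiS q - axiB q| < Real.sqrt ((axiS q - axiB q) ^ 2 + 4 * axiR q) :=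
    Real.lt_sqrt_of_sq_lt (by rw [sq_abs]; exact axi_disc_gt hq)
  have h2 : -(axiS q - axiB q) ≤ |axiS q - axiB q| := neg_le_abs _
  rw [cAxi]; linarith

/-- **`0 < c_axi(q)`** for `q > 1` (`R_q < S_qB_q`). [ours] -/
theorem cAxi_pos {q : ℝ} (hq : 1 < q) : 0 < cAxi q := by
  have hP := axiP_pos q; have hQ := axiQ_pos q
  have hS : 0 < axiS q := axiS_pos q
  have hB : 0 < axiB q := by rw [axiB_eq]; exact div_pos (by linarith) (by positivity)
  have hRSB : axiR q < axiS q * axiB q := by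
    rw [axiR_eq, axiS_eq, axiB_eq, div_mul_div_comm, ← pow_two]
    apply div_lt_div_of_pos_right _ (by positivity)
    nlinarith [mul_pos (by linarith : (0 : ℝ) < 3 * (q - 1)) (pow_pos hP 2)]
  have hlt : Real.sqrt ((axiS q - axiB q) ^ 2 + 4 * axiR q) < axiS q + axiB q := by
    rw [Real.sqrt_lt' (by linarith)]
    nlinarith
  rw [cAxi]; linarith

/-- **`T(2/3) < 0` for every `c_axi(q) < c ≤ S_q`**, `q > 1`. [ours] -/
theorem lineT_two_thirds_neg {q c : ℝ} (hq : 1 < q) (hc : cAxi q < c) (hcS : c ≤ axiS q) :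
    lineT q c (2 / 3) < 0 := by
  have hP := axiP_pos q; have hQ := axiQ_pos q
  set D : ℝ := (axiS q - axiB q) ^ 2 + 4 * axiR q with hD
  have hD0 : 0 ≤ D := by have := axiR_pos hq; positivity
  have h1 : |axiS q - axiB q| < Real.sqrt D := Real.lt_sqrt_of_sq_lt (by rw [sq_abs]; exact axi_disc_gt hq)
  have h2 : axiS q - axiB q ≤ |axiS q - axiB q| := le_abs_self _
  have hlo : -(Real.sqrt D / 2) < c - (axiS q + axiB q) / 2 := by rw [cAxi] at hc; linarith
  have hhi : c - (axiS q + axiB q) / 2 < Real.sqrt D / 2 := by linarith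
  have hsq : (c - (axiS q + axiB q) / 2) ^ 2 < (Real.sqrt D / 2) ^ 2 := sq_lt_sq' hlo hhi
  rw [div_pow, Real.sq_sqrt hD0] at hsq
  rw [lineT_two_thirds]
  have hpos : 0 < 27 / 4 * q ^ 2 * (axiP q / axiQ q) ^ 2 := by positivity
  exact mul_neg_of_pos_of_neg hpos (by linarith)

/-- Near the wall `u = 2/3`: `N > 0` and `T < 0` whenever this holds at `2/3`. [bookkeeping] -/
theorem exists_nhds_wall_rpow {q c : ℝ} (hN : 0 < lineN q c (2 / 3)) (hT : lineT q c (2 / 3) < 0) :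
    ∃ δ : ℝ, 0 < δ ∧ δ ≤ 1 / 3 ∧ ∀ u : ℝ, |u - 2 / 3| < δ → 0 < lineN q c u ∧ lineT q c u < 0 := by
  obtain ⟨cN, cT⟩ := continuousAt_lineN_lineT q c (u := 2 / 3) (by norm_num) (by norm_num)
  obtain ⟨δ₁, hδ₁, h₁⟩ := Metric.continuousAt_iff.mp cN (lineN q c (2 / 3)) hN
  obtain ⟨δ₂, hδ₂, h₂⟩ := Metric.continuousAt_iff.mp cT (-lineT q c (2 / 3)) (by linarith)
  refine ⟨min (min δ₁ δ₂) (1 / 3), by positivity, min_le_right _ _, fun u hu => ?_⟩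
  have hu1 : dist u (2 / 3) < δ₁ := by
    rw [Real.dist_eq]; exact hu.trans_le ((min_le_left _ _).trans (min_le_left _ _))
  have hu2 : dist u (2 / 3) < δ₂ := by
    rw [Real.dist_eq]; exact hu.trans_le ((min_le_left _ _).trans (min_le_right _ _))
  have e1 := h₁ hu1; have e2 := h₂ hu2; rw [Real.dist_eq] at e1 e2
  exact ⟨by linarith [abs_lt.mp e1], by linarith [abs_lt.mp e2]⟩

end TopEig

end Summit.NavierStokesRegularity.FunctionalMining

end
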